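import Literature.NumberTheory.Sieve.PolynomialValuesSieveSequence
import Literature.NumberTheory.Sieve.SieveFrameworkProofs
import Literature.NumberTheory.Sieve.MoebiusShiftedPrimesSieveBound
import HarnessLib

/-!
# Sieve bounds for the values of a polynomial with `ω(2) ≤ 1`, `ω(p) ≤ 2` along a progression

Topic `Literature/NumberTheory/Sieve`, companion of `PolynomialValuesSieveSequence.lean` (the sifted
sequence `polyAPSeq f N q r` of the values `f(n)`, `n ≤ N`, `n ≡ r (mod q)`, density
`rootDensity f = ω_f(m)/m`, remainder `|R_m| ≤ ω_f(m)`), general in `f ∈ ℤ[X]` with `ω_f(2) ≤ 1`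
and `ω_f(p) ≤ 2` for every prime `p` (any quadratic without fixed prime divisor at `2`, e.g.
`X² + 1`, or the Euler–Rabinowitsch polynomial `f_d = X² + X + (1 − d)/4`, `d ≡ 5 (mod 8)`, for
which `ω(2) = 0`, `ω(p) = 1 + (d/p)`). Everything is PROVED; no definition is introduced (the two
constants are written out: `Kω = 2 e^{17 + 12/log 2}`, the dimension-`2` constant, and
`Cω = flConst 2 Kω`, the constant of the tree's Fundamental Lemma
`SieveSequence.fundamental_lemma_explicit`). First client: the sieve-theoretic part (§6A, (6.1))
of Granville–Mollin, *Rabinowitsch revisited*, Acta Arith. 96 (2000), Theorem 4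
(`Literature.Barriers.Parity.GranvilleMollin2000_thm4`).

* `hasSieveDimension_rootDensity` — the density `ω_f(m)/m` satisfies `Ω(2)` with constant `Kω`:
  `∏_{w ≤ p < z} (1 − ω_f(p)/p)⁻¹ ≤ Kω (log z/log w)²` (Mertens over the window, exactly as in the
  tree's `Lichtman2020.hasSieveDimension_density`, whose Euler-factor inequality
  `Lichtman2020.inv_one_sub_two_div_le_exp` is reused — hence the import of
  `MoebiusShiftedPrimesSieveBound.lean`).
* `prod_one_sub_rootCount_pos`, `prod_one_sub_rootCount_le_one`, `prod_one_sub_rootCount_le_mul` —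
  `0 < V(z) ≤ 1`, `V(w) ≤ Kω (log z/log w)² V(z)` for `V(z) = ∏_{p<z} (1 − ω_f(p)/p)`.
* `sum_rootCount_divisors_le` — the remainder sum of the Fundamental Lemma for polynomial sequences:
  `∑_{m ∣ P(z), m ≤ D} ω_f(m) ≤ D ∏_{p<z} (1 + ω_f(p)/p) ≤ D e⁸ (log z)²` (Rankin's trick and
  Mertens, `MertensBound.sum_inv_prime_le`).
* `abs_card_coprime_sub_le` — the two-sided Fundamental Lemma for `{f(n) : 1 ≤ n ≤ N}`:
  `|#{n ≤ N : (f(n), P(z)) = 1} − N V(z)| ≤ Cω N V(z) e^{−log D/log z} + D e⁸ log² z`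
  (`2 ≤ z ≤ D`), the main term of Granville–Mollin's (6.1).
* `card_apIndex_coprime_le` — the upper-bound sieve for `{f(n) : n ≤ N, n ≡ r (mod q)}` when no
  prime `< z` divides `q`: `#{n ∈ apIndex N q r : (f(n), P(z)) = 1} ≤ (1 + Cω)(N/q) V(z) + D e⁸ log² z`,
  and `card_apIndex_coprime_le_of_le` (sifting by `P(y)`, `y ≥ z`, only removes more), the
  `O`-term of (6.1).

[cite: GranvilleMollin2000, §6A (6.1)] [cite: HalberstamRichert1974, Thm 2.5]
-/

noncomputable section

open Finset Real Polynomial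

namespace Literature.NumberTheory.Sieve

/-! ### Dimension `2` -/

/-- `0 ≤ ω_f(p)/p < 1` at every prime when `ω_f(2) ≤ 1` and `ω_f(p) ≤ 2`. [folklore] -/
theorem rootDensity_lt_one {f : ℤ[X]} (h2 : polyRootCountMod ![f] 2 ≤ 1)
    (hle : ∀ p : ℕ, p.Prime → polyRootCountMod ![f] p ≤ 2) {p : ℕ} (hp : p.Prime) :
    0 ≤ rootDensity f p ∧ rootDensity f p < 1 := by
  refine ⟨rootDensity_nonneg f p, ?_⟩
  rw [rootDensity_apply]
  have hp0 : (0 : ℝ) < p := by exact_mod_cast hp.pos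
  rw [div_lt_one hp0]
  rcases hp.eq_two_or_odd' with rfl | hodd
  · have : (polyRootCountMod ![f] 2 : ℝ) ≤ 1 := by exact_mod_cast h2
    push_cast
    linarith
  · have hp3 : 3 ≤ p := by
      have := hp.two_le
      rcases hodd with ⟨k, hk⟩
      omega
    have h3 : (3 : ℝ) ≤ p := by exact_mod_cast hp3
    have : (polyRootCountMod ![f] p : ℝ) ≤ 2 := by exact_mod_cast hle p hp
    linarith

/-- **The root-count density has sieve dimension `2`**: if `ω_f(2) ≤ 1` and `ω_f(p) ≤ 2` for all
primes `p`, then `0 ≤ ω_f(p)/p < 1` and `∏_{w ≤ p < z} (1 − ω_f(p)/p)⁻¹ ≤ Kω (log z/log w)²` for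
`2 ≤ w ≤ z`, `Kω = 2 e^{17 + 12/log 2}` (termwise `(1 − ω/p)⁻¹ ≤ [p = 2] 2 · exp(2/p + 8/(p(p−1)))`
and Mertens over the window, `sum_primesWindow_one_div_le`). [folklore] -/
theorem hasSieveDimension_rootDensity {f : ℤ[X]} (h2 : polyRootCountMod ![f] 2 ≤ 1)
    (hle : ∀ p : ℕ, p.Prime → polyRootCountMod ![f] p ≤ 2) :
    HasSieveDimension (rootDensity f) 2 (2 * Real.exp (17 + 12 / Real.log 2)) := by
  have hg : ∀ p : ℕ, p.Prime → 0 ≤ rootDensity f p ∧ rootDensity f p < 1 :=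
    fun p hp => rootDensity_lt_one h2 hle hp
  refine ⟨hg, fun w z hw hwz => ?_⟩
  set S := (Nat.primesBelow ⌈z⌉₊).filter (fun p : ℕ => w ≤ (p : ℝ)) with hS
  have hlogw : 0 < Real.log w := Real.log_pos (by linarith)
  have hlogz : 0 < Real.log z := Real.log_pos (by linarith)
  have hmemS : ∀ p ∈ S, p.Prime ∧ w ≤ (p : ℝ) ∧ p ≤ ⌊z⌋₊ := by
    intro p hp
    rw [hS, Finset.mem_filter, Nat.mem_primesBelow] at hp
    exact ⟨hp.1.2, hp.2, Nat.le_floor (Nat.lt_ceil.mp hp.1.1).le⟩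
  have hSle : S ⊆ Nat.primesLE ⌊z⌋₊ := fun p hp =>
    Nat.mem_primesLE.mpr ⟨(hmemS p hp).2.2, (hmemS p hp).1⟩
  set F : ℕ → ℝ := fun p => Real.exp (2 / (p : ℝ) + 8 * (1 / ((p : ℝ) * ((p : ℝ) - 1)))) with hF
  have hF1 : ∀ p ∈ S, 1 ≤ F p := fun p hp => by
    have hp2 : (2 : ℝ) ≤ p := by exact_mod_cast (hmemS p hp).1.two_le
    have : (0 : ℝ) < (p : ℝ) * ((p : ℝ) - 1) := mul_pos (by linarith) (by linarith)
    exact Real.one_le_exp (by positivity)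
  have hpt : ∀ p ∈ S, (1 - rootDensity f p)⁻¹ ≤ (if p = 2 then (2 : ℝ) else 1) * F p := by
    intro p hp
    have hpp := (hmemS p hp).1
    rw [rootDensity_apply]
    by_cases hp2 : p = 2
    · subst hp2
      rw [if_pos rfl]
      have hc1 : (polyRootCountMod ![f] 2 : ℝ) ≤ 1 := by exact_mod_cast h2
      calc (1 - (polyRootCountMod ![f] 2 : ℝ) / (2 : ℕ))⁻¹ ≤ (1 - 1 / 2)⁻¹ := by
            apply inv_anti₀ (by norm_num)
            push_cast
            linarith
        _ = 2 := by norm_num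
        _ ≤ 2 * F 2 := le_mul_of_one_le_right (by norm_num) (hF1 2 hp)
    · rw [if_neg hp2, one_mul]
      have hp3 : 3 ≤ p := by have := hpp.two_le; omega
      have hp3' : (3 : ℝ) ≤ p := by exact_mod_cast hp3
      have hc : (polyRootCountMod ![f] p : ℝ) / p ≤ 2 / p :=
        div_le_div_of_nonneg_right (by exact_mod_cast hle p hpp) (by linarith)
      have h23 : 2 / (p : ℝ) ≤ 2 / 3 := div_le_div_of_nonneg_left (by norm_num) (by norm_num) hp3'
      calc (1 - (polyRootCountMod ![f] p : ℝ) / p)⁻¹ ≤ (1 - 2 / (p : ℝ))⁻¹ :=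
            inv_anti₀ (by linarith) (by linarith)
        _ ≤ F p := Lichtman2020.inv_one_sub_two_div_le_exp hp3'
  have hnonneg : ∀ p ∈ S, 0 ≤ (1 - rootDensity f p)⁻¹ := fun p hp =>
    inv_nonneg.mpr (sub_nonneg.mpr (hg p (hmemS p hp).1).2.le)
  have hsum1 : ∑ p ∈ S, (1 : ℝ) / p ≤
      Real.log (Real.log z) - Real.log (Real.log w) + (9 / 2 + 6 / Real.log 2) :=
    sum_primesWindow_one_div_le hw hwz
  have hsum2 : ∑ p ∈ S, (1 : ℝ) / (p * (p - 1)) ≤ 1 :=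
    (Finset.sum_le_sum_of_subset_of_nonneg hSle fun p hp _ => by
      have hp2 : (2 : ℝ) ≤ p := by exact_mod_cast (Nat.mem_primesLE.mp hp).2.two_le
      have : (0 : ℝ) < p * (p - 1) := mul_pos (by linarith) (by linarith)
      positivity).trans
      (Literature.NumberTheory.LFunctions.MertensBound.sum_inv_prime_mul_pred_le_one ⌊z⌋₊)
  have hprod2 : ∏ p ∈ S, (if p = 2 then (2 : ℝ) else 1) ≤ 2 := by
    have : ∏ p ∈ S, (if p = 2 then (2 : ℝ) else 1) = if 2 ∈ S then 2 else 1 :=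
      Finset.prod_ite_eq' S 2 (fun _ => (2 : ℝ))
    rw [this]
    split_ifs <;> norm_num
  have hE : Real.exp (Real.log (Real.log z) - Real.log (Real.log w)) = Real.log z / Real.log w := by
    rw [Real.exp_sub, Real.exp_log hlogz, Real.exp_log hlogw]
  calc ∏ p ∈ S, (1 - rootDensity f p)⁻¹
      ≤ ∏ p ∈ S, ((if p = 2 then (2 : ℝ) else 1) * F p) := Finset.prod_le_prod hnonneg hpt
    _ = (∏ p ∈ S, (if p = 2 then (2 : ℝ) else 1)) * ∏ p ∈ S, F p := Finset.prod_mul_distrib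
    _ ≤ 2 * ∏ p ∈ S, F p :=
        mul_le_mul_of_nonneg_right hprod2 (Finset.prod_nonneg fun p _ => (Real.exp_pos _).le)
    _ = 2 * Real.exp (∑ p ∈ S, (2 / (p : ℝ) + 8 * (1 / ((p : ℝ) * ((p : ℝ) - 1))))) := by
        rw [hF, Real.exp_sum]
    _ = 2 * Real.exp (2 * ∑ p ∈ S, 1 / (p : ℝ) + 8 * ∑ p ∈ S, 1 / ((p : ℝ) * ((p : ℝ) - 1))) := by
        rw [Finset.sum_add_distrib, Finset.mul_sum, Finset.mul_sum]
        congr 3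
        refine Finset.sum_congr rfl fun p _ => ?_
        rw [mul_one_div]
    _ ≤ 2 * Real.exp (2 * (Real.log (Real.log z) - Real.log (Real.log w) + (9 / 2 + 6 / Real.log 2))
          + 8 * 1) :=
        mul_le_mul_of_nonneg_left (Real.exp_le_exp.mpr (by linarith)) (by norm_num)
    _ = 2 * Real.exp ((17 + 12 / Real.log 2) +
          ((Real.log (Real.log z) - Real.log (Real.log w)) +
            (Real.log (Real.log z) - Real.log (Real.log w)))) := by
        congr 2; ring
    _ = (2 * Real.exp (17 + 12 / Real.log 2)) * (Real.log z / Real.log w) ^ (2 : ℝ) := by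
        rw [Real.exp_add (17 + 12 / Real.log 2),
          Real.exp_add (Real.log (Real.log z) - Real.log (Real.log w)), hE, Real.rpow_two]
        ring

/-! ### `V(z) = ∏_{p<z} (1 − ω_f(p)/p)` -/

/-- `0 < V(z)` when `ω_f(2) ≤ 1`, `ω_f(p) ≤ 2`. [folklore] -/
theorem prod_one_sub_rootCount_pos {f : ℤ[X]} (h2 : polyRootCountMod ![f] 2 ≤ 1)
    (hle : ∀ p : ℕ, p.Prime → polyRootCountMod ![f] p ≤ 2) (z : ℝ) :
    0 < ∏ p ∈ Nat.primesBelow ⌈z⌉₊, (1 - (polyRootCountMod ![f] p : ℝ) / p) := by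
  refine Finset.prod_pos fun p hp => ?_
  have h := (rootDensity_lt_one h2 hle (Nat.prime_of_mem_primesBelow hp)).2
  rw [rootDensity_apply] at h
  linarith

/-- `V(z) ≤ 1`. [folklore] -/
theorem prod_one_sub_rootCount_le_one (f : ℤ[X]) (z : ℝ) :
    ∏ p ∈ Nat.primesBelow ⌈z⌉₊, (1 - (polyRootCountMod ![f] p : ℝ) / p) ≤ 1 := by
  refine Finset.prod_le_one (fun p hp => ?_) (fun p _ => ?_)
  · have h := rootDensity_le_one f p
    rw [rootDensity_apply] at h
    linarith
  · have h := rootDensity_nonneg f p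
    rw [rootDensity_apply] at h
    linarith

/-- **`V(w) ≤ Kω (log z/log w)² V(z)` for `2 ≤ w ≤ z`** (the dimension condition). [folklore] -/
theorem prod_one_sub_rootCount_le_mul {f : ℤ[X]} (h2 : polyRootCountMod ![f] 2 ≤ 1)
    (hle : ∀ p : ℕ, p.Prime → polyRootCountMod ![f] p ≤ 2) {w z : ℝ} (hw : 2 ≤ w) (hwz : w ≤ z) :
    ∏ p ∈ Nat.primesBelow ⌈w⌉₊, (1 - (polyRootCountMod ![f] p : ℝ) / p) ≤
      (2 * Real.exp (17 + 12 / Real.log 2)) * (Real.log z / Real.log w) ^ (2 : ℝ) *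
        ∏ p ∈ Nat.primesBelow ⌈z⌉₊, (1 - (polyRootCountMod ![f] p : ℝ) / p) := by
  have h := SieveSequence.densityProduct_le_of_dim (A := polyAPSeq f 0 1 0)
    (hasSieveDimension_rootDensity h2 hle) hw hwz
  rwa [polyAPSeq_densityProduct, polyAPSeq_densityProduct] at h

/-! ### The remainder sum `∑_{m ∣ P(z), m ≤ D} ω_f(m)` -/

/-- `∑_{p < z} 1/p ≤ log log z + 4` for `z ≥ 2` (the tree's `MertensBound.sum_inv_prime_le` at
`⌊z⌋`). [folklore] -/
theorem sum_primesBelow_one_div_le {z : ℝ} (hz : 2 ≤ z) :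
    ∑ p ∈ Nat.primesBelow ⌈z⌉₊, (1 : ℝ) / p ≤ Real.log (Real.log z) + 4 := by
  have hfz : 2 ≤ ⌊z⌋₊ := Nat.le_floor (by exact_mod_cast hz)
  have hsub : Nat.primesBelow ⌈z⌉₊ ⊆ Nat.primesLE ⌊z⌋₊ := fun p hp => by
    rw [Nat.mem_primesBelow] at hp
    exact Nat.mem_primesLE.mpr ⟨Nat.le_floor (Nat.lt_ceil.mp hp.1).le, hp.2⟩
  have h1 := Literature.NumberTheory.LFunctions.MertensBound.sum_inv_prime_le ⌊z⌋₊ hfz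
  have hfl : (2 : ℝ) ≤ (⌊z⌋₊ : ℝ) := by exact_mod_cast hfz
  have hflz : (⌊z⌋₊ : ℝ) ≤ z := Nat.floor_le (by linarith)
  have hlog : Real.log (⌊z⌋₊ : ℝ) ≤ Real.log z := Real.log_le_log (by linarith) hflz
  have hlogpos : 0 < Real.log (⌊z⌋₊ : ℝ) := Real.log_pos (by linarith)
  have hll : Real.log (Real.log (⌊z⌋₊ : ℝ)) ≤ Real.log (Real.log z) := Real.log_le_log hlogpos hlog
  exact (Finset.sum_le_sum_of_subset_of_nonneg hsub fun p _ _ => by positivity).trans (by linarith)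

/-- `∏_{p<z} (1 + ω_f(p)/p) ≤ e⁸ (log z)²` for `z ≥ 2` when `ω_f(p) ≤ 2`. [folklore] -/
theorem prod_one_add_rootDensity_le {f : ℤ[X]} (hle : ∀ p : ℕ, p.Prime → polyRootCountMod ![f] p ≤ 2)
    {z : ℝ} (hz : 2 ≤ z) :
    ∏ p ∈ Nat.primesBelow ⌈z⌉₊, (1 + rootDensity f p) ≤ Real.exp 8 * Real.log z ^ 2 := by
  have hlogz : 0 < Real.log z := Real.log_pos (by linarith)
  calc ∏ p ∈ Nat.primesBelow ⌈z⌉₊, (1 + rootDensity f p)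
      ≤ ∏ p ∈ Nat.primesBelow ⌈z⌉₊, Real.exp (2 * (1 / (p : ℝ))) := by
        refine Finset.prod_le_prod (fun p _ => ?_) (fun p hp => ?_)
        · linarith [rootDensity_nonneg f p]
        · have hpp := Nat.prime_of_mem_primesBelow hp
          have hp0 : (0 : ℝ) < p := by exact_mod_cast hpp.pos
          have hg : rootDensity f p ≤ 2 * (1 / (p : ℝ)) := by
            rw [rootDensity_apply, mul_one_div]
            exact div_le_div_of_nonneg_right (by exact_mod_cast hle p hpp) hp0.le
          linarith [Real.add_one_le_exp (2 * (1 / (p : ℝ)))]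
    _ = Real.exp (2 * ∑ p ∈ Nat.primesBelow ⌈z⌉₊, (1 : ℝ) / p) := by
        rw [Finset.mul_sum, Real.exp_sum]
    _ ≤ Real.exp (2 * (Real.log (Real.log z) + 4)) :=
        Real.exp_le_exp.mpr (by linarith [sum_primesBelow_one_div_le hz])
    _ = Real.exp 8 * Real.log z ^ 2 := by
        rw [show 2 * (Real.log (Real.log z) + 4) = 8 + Real.log (Real.log z) * 2 by ring,
          Real.exp_add, Real.exp_mul, Real.exp_log hlogz, Real.rpow_two]

/-- **The remainder sum for polynomial sequences** (Rankin's trick): for `D ≥ 0`, `z ≥ 2` and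
`ω_f(p) ≤ 2`, `∑_{m ∣ P(z), m ≤ D} ω_f(m) ≤ D ∑_{m ∣ P(z)} ω_f(m)/m = D ∏_{p<z} (1 + ω_f(p)/p)
≤ D e⁸ (log z)²`. [folklore] -/
theorem sum_rootCount_divisors_le {f : ℤ[X]} (hle : ∀ p : ℕ, p.Prime → polyRootCountMod ![f] p ≤ 2)
    {z D : ℝ} (hz : 2 ≤ z) (hD : 0 ≤ D) :
    ∑ m ∈ (primesProdBelow z).divisors.filter (fun m : ℕ => (m : ℝ) ≤ D),
        (polyRootCountMod ![f] m : ℝ) ≤ D * (Real.exp 8 * Real.log z ^ 2) := by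
  have hP : Squarefree (primesProdBelow z) := squarefree_primesProdBelow z
  calc ∑ m ∈ (primesProdBelow z).divisors.filter (fun m : ℕ => (m : ℝ) ≤ D),
          (polyRootCountMod ![f] m : ℝ)
      ≤ ∑ m ∈ (primesProdBelow z).divisors.filter (fun m : ℕ => (m : ℝ) ≤ D),
          D * rootDensity f m := by
        refine Finset.sum_le_sum fun m hm => ?_
        obtain ⟨hmd, hmD⟩ := Finset.mem_filter.mp hm
        have hm0 : (0 : ℝ) < m := by exact_mod_cast Nat.pos_of_mem_divisors hmd
        rw [rootDensity_apply]
        calc (polyRootCountMod ![f] m : ℝ) = (polyRootCountMod ![f] m : ℝ) / m * m := by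
              field_simp
          _ ≤ (polyRootCountMod ![f] m : ℝ) / m * D :=
              mul_le_mul_of_nonneg_left hmD (by positivity)
          _ = D * ((polyRootCountMod ![f] m : ℝ) / m) := by ring
    _ ≤ ∑ m ∈ (primesProdBelow z).divisors, D * rootDensity f m :=
        Finset.sum_le_sum_of_subset_of_nonneg (Finset.filter_subset _ _)
          fun m _ _ => mul_nonneg hD (rootDensity_nonneg f m)
    _ = D * ∏ p ∈ Nat.primesBelow ⌈z⌉₊, (1 + rootDensity f p) := by
        rw [← Finset.mul_sum, ← primeFactors_primesProdBelow,
          (isMultiplicative_rootDensity f).prodPrimeFactors_one_add_of_squarefree hP]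
    _ ≤ D * (Real.exp 8 * Real.log z ^ 2) :=
        mul_le_mul_of_nonneg_left (prod_one_add_rootDensity_le hle hz) hD

/-! ### The Fundamental Lemma for polynomial sequences -/

/-- **Two-sided Fundamental Lemma for `{f(n) : 1 ≤ n ≤ N}`** (Halberstam–Richert Thm 2.5 applied
to Example 5; the main term of Granville–Mollin (6.1)): if `ω_f(2) ≤ 1`, `ω_f(p) ≤ 2`,
`0 < f(n) ≤ x` for `1 ≤ n ≤ N`, and `2 ≤ z ≤ D`, then
`|#{1 ≤ n ≤ N : (f(n), P(z)) = 1} − N V(z)| ≤ Cω N V(z) e^{−log D/log z} + D e⁸ log² z`,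
`V(z) = ∏_{p<z}(1 − ω_f(p)/p)`. [cite: GranvilleMollin2000, §6A (6.1)] -/
theorem abs_card_coprime_sub_le {f : ℤ[X]} (h2 : polyRootCountMod ![f] 2 ≤ 1)
    (hle : ∀ p : ℕ, p.Prime → polyRootCountMod ![f] p ≤ 2) {N : ℕ} {x z D : ℝ}
    (hz : 2 ≤ z) (hzD : z ≤ D)
    (hx : ∀ n ∈ Ioc 0 N, 0 < f.eval (n : ℤ) ∧ ((f.eval (n : ℤ) : ℤ) : ℝ) ≤ x) :
    |(#((Ioc 0 N).filter fun n : ℕ => (f.eval (n : ℤ)).natAbs.Coprime (primesProdBelow z)) : ℝ) -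
        N * ∏ p ∈ Nat.primesBelow ⌈z⌉₊, (1 - (polyRootCountMod ![f] p : ℝ) / p)| ≤
      SieveSequence.flConst 2 (2 * Real.exp (17 + 12 / Real.log 2)) * N * (∏ p ∈ Nat.primesBelow ⌈z⌉₊, (1 - (polyRootCountMod ![f] p : ℝ) / p)) *
          Real.exp (-(Real.log D / Real.log z)) +
        D * (Real.exp 8 * Real.log z ^ 2) := by
  set A := polyAPSeq f N 1 0 with hA
  have hx' : ∀ n ∈ apIndex N 1 0, 0 < f.eval (n : ℤ) ∧ ((f.eval (n : ℤ) : ℤ) : ℝ) ≤ x := by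
    rw [apIndex_one]; exact hx
  have hdim : HasSieveDimension A.density 2 (2 * Real.exp (17 + 12 / Real.log 2)) := hasSieveDimension_rootDensity h2 hle
  have hX : 0 ≤ A.size x := by rw [hA, polyAPSeq_size]; positivity
  have hFL := SieveSequence.fundamental_lemma_explicit hdim (by norm_num : (0 : ℝ) < 2) hz hzD hX
  rw [hA, polyAPSeq_sifted f N 1 0 hx', polyAPSeq_size, polyAPSeq_densityProduct, apIndex_one,
    Nat.cast_one, div_one] at hFL
  have hR := sum_abs_remainder_polyAPSeq_le f (N := N) (r := 0) Nat.one_pos (z := z) (D := D)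
    (fun p hp _ => hp.not_dvd_one) hx'
  have hD : 0 ≤ D := by linarith
  have hR' := hR.trans (sum_rootCount_divisors_le hle hz hD)
  linarith

/-- **Upper-bound sieve for `{f(n) : n ≤ N, n ≡ r (mod q)}`** (the `O`-term of Granville–Mollin
(6.1)): if `ω_f(2) ≤ 1`, `ω_f(p) ≤ 2`, `q ≥ 1` has no prime factor `< z`, `0 < f(n) ≤ x` on the
progression, and `2 ≤ z ≤ D`, then
`#{n ∈ apIndex N q r : (f(n), P(z)) = 1} ≤ (1 + Cω)(N/q) V(z) + D e⁸ log² z`. [cite: GranvilleMollin2000, §6A (6.1)] -/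
theorem card_apIndex_coprime_le {f : ℤ[X]} (h2 : polyRootCountMod ![f] 2 ≤ 1)
    (hle : ∀ p : ℕ, p.Prime → polyRootCountMod ![f] p ≤ 2) {N q r : ℕ} (hq : 0 < q) {x z D : ℝ}
    (hz : 2 ≤ z) (hzD : z ≤ D) (hqz : ∀ p : ℕ, p.Prime → (p : ℝ) < z → ¬ p ∣ q)
    (hx : ∀ n ∈ apIndex N q r, 0 < f.eval (n : ℤ) ∧ ((f.eval (n : ℤ) : ℤ) : ℝ) ≤ x) :
    (#((apIndex N q r).filter fun n : ℕ => (f.eval (n : ℤ)).natAbs.Coprime (primesProdBelow z)) : ℝ)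
      ≤ (1 + SieveSequence.flConst 2 (2 * Real.exp (17 + 12 / Real.log 2))) * ((N : ℝ) / q) * ∏ p ∈ Nat.primesBelow ⌈z⌉₊, (1 - (polyRootCountMod ![f] p : ℝ) / p) +
        D * (Real.exp 8 * Real.log z ^ 2) := by
  set A := polyAPSeq f N q r with hA
  have hdim : HasSieveDimension A.density 2 (2 * Real.exp (17 + 12 / Real.log 2)) := hasSieveDimension_rootDensity h2 hle
  have hX : 0 ≤ A.size x := by rw [hA, polyAPSeq_size]; positivity
  have hFL := SieveSequence.fundamental_lemma_explicit hdim (by norm_num : (0 : ℝ) < 2) hz hzD hX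
  rw [hA, polyAPSeq_sifted f N q r hx, polyAPSeq_size, polyAPSeq_densityProduct] at hFL
  have hR := sum_abs_remainder_polyAPSeq_le f (N := N) (r := r) hq (z := z) (D := D) hqz hx
  have hD : 0 ≤ D := by linarith
  have hR' := hR.trans (sum_rootCount_divisors_le hle hz hD)
  set V := ∏ p ∈ Nat.primesBelow ⌈z⌉₊, (1 - (polyRootCountMod ![f] p : ℝ) / p) with hV
  have hV0 : 0 < V := prod_one_sub_rootCount_pos h2 hle z
  have hC0 : 0 < SieveSequence.flConst 2 (2 * Real.exp (17 + 12 / Real.log 2)) := SieveSequence.flConst_pos (by norm_num) (by positivity)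
  have hexp : Real.exp (-(Real.log D / Real.log z)) ≤ 1 := by
    rw [Real.exp_le_one_iff, neg_nonpos]
    exact div_nonneg (Real.log_nonneg (by linarith)) (Real.log_nonneg (by linarith))
  have hNq : (0 : ℝ) ≤ N / q := by positivity
  have h1 : SieveSequence.flConst 2 (2 * Real.exp (17 + 12 / Real.log 2)) * (N / q) * V * Real.exp (-(Real.log D / Real.log z)) ≤ SieveSequence.flConst 2 (2 * Real.exp (17 + 12 / Real.log 2)) * (N / q) * V := by
    refine mul_le_of_le_one_right ?_ hexp
    have := hV0.le
    positivity
  have h2' := (abs_le.mp hFL).2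
  nlinarith

/-- Sifting by more primes only removes terms: for `z ≤ y`,
`#{n ∈ S : (f(n), P(y)) = 1} ≤ #{n ∈ S : (f(n), P(z)) = 1}`. [folklore] -/
theorem card_coprime_primesProdBelow_mono (f : ℤ[X]) (S : Finset ℕ) {z y : ℝ} (hzy : z ≤ y) :
    #(S.filter fun n : ℕ => (f.eval (n : ℤ)).natAbs.Coprime (primesProdBelow y)) ≤
      #(S.filter fun n : ℕ => (f.eval (n : ℤ)).natAbs.Coprime (primesProdBelow z)) :=
  Finset.card_le_card fun n hn => by
    rw [Finset.mem_filter] at hn ⊢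
    exact ⟨hn.1, hn.2.coprime_dvd_right (SieveSequence.primesProdBelow_dvd hzy)⟩

/-- **Upper-bound sieve, sifting range `P(y)` with `y ≥ z`**: under the hypotheses of
`card_apIndex_coprime_le`, `#{n ∈ apIndex N q r : (f(n), P(y)) = 1} ≤ (1 + Cω)(N/q) V(z) +
D e⁸ log² z`. [cite: GranvilleMollin2000, §6A (6.1)] -/
theorem card_apIndex_coprime_le_of_le {f : ℤ[X]} (h2 : polyRootCountMod ![f] 2 ≤ 1)
    (hle : ∀ p : ℕ, p.Prime → polyRootCountMod ![f] p ≤ 2) {N q r : ℕ} (hq : 0 < q) {x z y D : ℝ}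
    (hz : 2 ≤ z) (hzD : z ≤ D) (hzy : z ≤ y) (hqz : ∀ p : ℕ, p.Prime → (p : ℝ) < z → ¬ p ∣ q)
    (hx : ∀ n ∈ apIndex N q r, 0 < f.eval (n : ℤ) ∧ ((f.eval (n : ℤ) : ℤ) : ℝ) ≤ x) :
    (#((apIndex N q r).filter fun n : ℕ => (f.eval (n : ℤ)).natAbs.Coprime (primesProdBelow y)) : ℝ)
      ≤ (1 + SieveSequence.flConst 2 (2 * Real.exp (17 + 12 / Real.log 2))) * ((N : ℝ) / q) * ∏ p ∈ Nat.primesBelow ⌈z⌉₊, (1 - (polyRootCountMod ![f] p : ℝ) / p) +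
        D * (Real.exp 8 * Real.log z ^ 2) :=
  le_trans (by exact_mod_cast card_coprime_primesProdBelow_mono f _ hzy)
    (card_apIndex_coprime_le h2 hle hq hz hzD hqz hx)

end Literature.NumberTheory.Sieve
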